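import Summits.Ventures.YMGap.RobustBall.BoundaryFreeEnergyBoxes
import HarnessLib

/-!
# Venture YMGap, track ROBUST-BALL — VOLUME ASYMPTOTICS OF THE CUBES OF `ℤ^d`: collars of fixed width are negligible, and the number of plaquettes
# touching the links of a cube is asymptotic to the number of plaquettes based in it

HONEST FRAMING. WHAT THIS IS: a venture file (cell `pub-ymgap`, track Y2 ROBUST-BALL / DS, seat ds-3, theorems only, 0 compute): elementary counting and
limits for the cubes `B_M = siteBox d M` (`#B_M = (2M+1)^d`), their link sets `Λ_M = boxLinks d M` and the plaquettes touching them, used by the van Hove /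
large-deviation files of the track (`BoundaryStateEntropyBoxesDim`, `EntropyMethodLowerBound`, `EnergyLargeDeviations*`):
* `tendsto_collar_fraction_dim` — `((2M+3)^d − (2(M−K)+1)^d)/(2M+1)^d → 0`;
* `card_plaquettesTouching_boxLinks_ge` / `_le` — `#planes(d)·(2M+1)^d ≤ #T(Λ_M) ≤ #planes(d)·(2M+3)^d`;
* `tendsto_card_siteBox_atTop` — `#B_M → ∞` (`d ≥ 1`);
* `tendsto_card_plaquettesTouching_boxLinks_div` — `#T(Λ_M)/(#B_M·#planes(d)) → 1`, and `tendsto_card_plaquettesTouching_div` —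
  `#T(Λ_{M+1})/(#B_M·#planes(d)) → 1` (`d ≥ 2`).
WHAT THIS IS NOT: bookkeeping only; nothing about measures. Everything here is proved. [folklore]
-/

noncomputable section

open Filter Topology Real Finset Set
open Literature.Probability.LatticeModels hiding configShift configShift_apply
open Literature.MathematicalPhysics.QuantumLattice

namespace Summit.Ventures.YMGap.RobustBall

namespace BoundaryFreeEnergy

variable {d : ℕ}

/-- **The relative size of a collar of fixed width tends to zero**: `((2M+3)^d − (2(M−K)+1)^d)/(2M+1)^d → 0` as `M → ∞`. [folklore] -/
theorem tendsto_collar_fraction_dim (d K : ℕ) :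
    Tendsto (fun M : ℕ => ((2 * (M : ℝ) + 3) ^ d - (2 * ((M : ℝ) - K) + 1) ^ d) / (2 * (M : ℝ) + 1) ^ d) atTop (𝓝 0) := by
  have hM : Tendsto (fun M : ℕ => 2 * (M : ℝ) + 1) atTop atTop :=
    tendsto_atTop_add_const_right _ _ (Tendsto.const_mul_atTop (by norm_num) tendsto_natCast_atTop_atTop)
  have h1 : Tendsto (fun M : ℕ => (1 + 2 / (2 * (M : ℝ) + 1)) ^ d) atTop (𝓝 ((1 + 0) ^ d)) :=
    (tendsto_const_nhds.add (tendsto_const_nhds.div_atTop hM)).pow d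
  have h2 : Tendsto (fun M : ℕ => (1 - 2 * (K : ℝ) / (2 * (M : ℝ) + 1)) ^ d) atTop (𝓝 ((1 - 0) ^ d)) :=
    (tendsto_const_nhds.sub (tendsto_const_nhds.div_atTop hM)).pow d
  have h3 := h1.sub h2
  rw [add_zero, sub_zero, one_pow, sub_self] at h3
  refine h3.congr' ?_
  filter_upwards [eventually_ge_atTop 0] with M _
  have hpos : (0 : ℝ) < 2 * (M : ℝ) + 1 := by positivity
  have e1 : 1 + 2 / (2 * (M : ℝ) + 1) = (2 * (M : ℝ) + 3) / (2 * (M : ℝ) + 1) := by field_simp; ring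
  have e2 : 1 - 2 * (K : ℝ) / (2 * (M : ℝ) + 1) = (2 * ((M : ℝ) - K) + 1) / (2 * (M : ℝ) + 1) := by field_simp; ring
  rw [e1, e2, div_pow, div_pow, sub_div]

/-- Every plaquette based in the cube touches the cube's links (every `d`; the `d`-generic counting of
`BoundaryFreeEnergyBoxesDim`, kept private here so that this file depends on built modules only). [folklore] -/
private theorem siteBox_product_subset_plaquettesTouching_aux (M : ℕ) :
    (siteBox d M) ×ˢ (Finset.univ : Finset {q : Fin d × Fin d // q.1 < q.2}) ⊆ plaquettesTouching (boxLinks d M) := by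
  intro p hp
  rw [Finset.mem_product] at hp
  rw [mem_plaquettesTouching_iff]
  refine ⟨(p.1, p.2.1.1), Finset.mem_inter.2 ⟨by simp [plaquetteEdges], ?_⟩⟩
  rw [mem_boxLinks]; exact hp.1

/-- Every plaquette touching the cube's links is based in the next cube (every `d`; private copy as above). [folklore] -/
private theorem plaquettesTouching_boxLinks_subset_aux (M : ℕ) :
    plaquettesTouching (boxLinks d M) ⊆ (siteBox d (M + 1)) ×ˢ (Finset.univ : Finset {q : Fin d × Fin d // q.1 < q.2}) := by
  intro p hp
  rw [mem_plaquettesTouching_iff] at hp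
  obtain ⟨x, hx⟩ := hp
  obtain ⟨hxp, hxΛ⟩ := Finset.mem_inter.1 hx
  rw [mem_boxLinks, mem_siteBox_iff_norm] at hxΛ
  rw [Finset.mem_product]
  refine ⟨mem_siteBox_of_norm_lt ?_, Finset.mem_univ _⟩
  have h := norm_fst_le_norm_add_one_of_mem_plaquetteEdges hxp
  push_cast; linarith

/-- **The number of plaquettes touching the next cube per plaquette based in the cube tends to one**:
`#T(boxLinks d (M+1))/(#B_M · #planes) → 1`. [folklore] -/
theorem tendsto_card_plaquettesTouching_div (hd : 2 ≤ d) :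
    Tendsto (fun M : ℕ => ((plaquettesTouching (boxLinks d (M + 1))).card : ℝ) /
      ((siteBox d M).card * Fintype.card {q : Fin d × Fin d // q.1 < q.2})) atTop (𝓝 1) := by
  have hpl : 0 < Fintype.card {q : Fin d × Fin d // q.1 < q.2} := by
    have : Nonempty {q : Fin d × Fin d // q.1 < q.2} := ⟨⟨(⟨0, by omega⟩, ⟨1, by omega⟩), by simp [Fin.lt_def]⟩⟩
    exact Fintype.card_pos
  have hplpos : (0 : ℝ) < Fintype.card {q : Fin d × Fin d // q.1 < q.2} := by exact_mod_cast hpl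
  set np : ℝ := (Fintype.card {q : Fin d × Fin d // q.1 < q.2} : ℝ) with hnp
  -- `np (2M+3)^d ≤ #T(Λ_{M+1}) ≤ np (2M+5)^d` and `#B_M = (2M+1)^d`
  have hlo : ∀ M : ℕ, np * (2 * (M : ℝ) + 3) ^ d ≤ ((plaquettesTouching (boxLinks d (M + 1))).card : ℝ) := by
    intro M
    have h := Finset.card_le_card (siteBox_product_subset_plaquettesTouching_aux (d := d) (M + 1))
    rw [Finset.card_product, ThermodynamicVariance.card_siteBox, Finset.card_univ] at h
    have h' : (((2 * (M + 1) + 1) ^ d * Fintype.card {q : Fin d × Fin d // q.1 < q.2} : ℕ) : ℝ) ≤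
        ((plaquettesTouching (boxLinks d (M + 1))).card : ℝ) := by exact_mod_cast h
    push_cast at h'
    rw [show (2 * ((M : ℝ) + 1) + 1) = 2 * (M : ℝ) + 3 by ring] at h'
    rw [hnp]; linarith [h']
  have hhi : ∀ M : ℕ, ((plaquettesTouching (boxLinks d (M + 1))).card : ℝ) ≤ np * (2 * (M : ℝ) + 5) ^ d := by
    intro M
    have h := Finset.card_le_card (plaquettesTouching_boxLinks_subset_aux (d := d) (M + 1))
    rw [Finset.card_product, ThermodynamicVariance.card_siteBox, Finset.card_univ] at h
    have h' : ((plaquettesTouching (boxLinks d (M + 1))).card : ℝ) ≤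
        (((2 * (M + 1 + 1) + 1) ^ d * Fintype.card {q : Fin d × Fin d // q.1 < q.2} : ℕ) : ℝ) := by exact_mod_cast h
    push_cast at h'
    rw [show (2 * ((M : ℝ) + 1 + 1) + 1) = 2 * (M : ℝ) + 5 by ring] at h'
    rw [hnp]; linarith [h']
  have hM : Tendsto (fun M : ℕ => 2 * (M : ℝ) + 1) atTop atTop :=
    tendsto_atTop_add_const_right _ _ (Tendsto.const_mul_atTop (by norm_num) tendsto_natCast_atTop_atTop)
  have h1 : Tendsto (fun M : ℕ => (1 + 2 / (2 * (M : ℝ) + 1)) ^ d) atTop (𝓝 ((1 + 0) ^ d)) :=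
    (tendsto_const_nhds.add (tendsto_const_nhds.div_atTop hM)).pow d
  have h2 : Tendsto (fun M : ℕ => (1 + 4 / (2 * (M : ℝ) + 1)) ^ d) atTop (𝓝 ((1 + 0) ^ d)) :=
    (tendsto_const_nhds.add (tendsto_const_nhds.div_atTop hM)).pow d
  rw [add_zero, one_pow] at h1 h2
  refine tendsto_of_tendsto_of_tendsto_of_le_of_le' h1 h2 ?_ ?_
  · filter_upwards [eventually_ge_atTop 0] with M _
    have hB : ((siteBox d M).card : ℝ) = (2 * (M : ℝ) + 1) ^ d := by
      rw [ThermodynamicVariance.card_siteBox]; push_cast; ring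
    have hpos : (0 : ℝ) < 2 * (M : ℝ) + 1 := by positivity
    rw [hB, show 1 + 2 / (2 * (M : ℝ) + 1) = (2 * (M : ℝ) + 3) / (2 * (M : ℝ) + 1) by field_simp; ring, div_pow,
      div_le_div_iff₀ (by positivity) (by positivity)]
    nlinarith [hlo M, pow_pos hpos d]
  · filter_upwards [eventually_ge_atTop 0] with M _
    have hB : ((siteBox d M).card : ℝ) = (2 * (M : ℝ) + 1) ^ d := by
      rw [ThermodynamicVariance.card_siteBox]; push_cast; ring
    have hpos : (0 : ℝ) < 2 * (M : ℝ) + 1 := by positivity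
    rw [hB, show 1 + 4 / (2 * (M : ℝ) + 1) = (2 * (M : ℝ) + 5) / (2 * (M : ℝ) + 1) by field_simp; ring, div_pow,
      div_le_div_iff₀ (by positivity) (by positivity)]
    nlinarith [hhi M, pow_pos hpos d]


/-- **Two-sided count of the plaquettes touching a cube's links**: `#planes(d)·(2M+1)^d ≤ #T(boxLinks d M) ≤ #planes(d)·(2M+3)^d`. [folklore] -/
theorem card_plaquettesTouching_boxLinks_ge_le (M : ℕ) :
    (Fintype.card {q : Fin d × Fin d // q.1 < q.2} : ℝ) * (2 * (M : ℝ) + 1) ^ d ≤ ((plaquettesTouching (boxLinks d M)).card : ℝ) ∧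
    ((plaquettesTouching (boxLinks d M)).card : ℝ) ≤ (Fintype.card {q : Fin d × Fin d // q.1 < q.2} : ℝ) * (2 * (M : ℝ) + 3) ^ d := by
  constructor
  · have h := Finset.card_le_card (siteBox_product_subset_plaquettesTouching_aux (d := d) M)
    rw [Finset.card_product, ThermodynamicVariance.card_siteBox, Finset.card_univ] at h
    have h' : (((2 * M + 1) ^ d * Fintype.card {q : Fin d × Fin d // q.1 < q.2} : ℕ) : ℝ) ≤ ((plaquettesTouching (boxLinks d M)).card : ℝ) := by
      exact_mod_cast h
    push_cast at h'
    linarith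
  · have h := Finset.card_le_card (plaquettesTouching_boxLinks_subset_aux (d := d) M)
    rw [Finset.card_product, ThermodynamicVariance.card_siteBox, Finset.card_univ] at h
    have h' : ((plaquettesTouching (boxLinks d M)).card : ℝ) ≤ (((2 * (M + 1) + 1) ^ d * Fintype.card {q : Fin d × Fin d // q.1 < q.2} : ℕ) : ℝ) := by
      exact_mod_cast h
    push_cast at h'
    rw [show (2 * ((M : ℝ) + 1) + 1) = 2 * (M : ℝ) + 3 by ring] at h'
    linarith

/-- `#B_M = (2M+1)^d → ∞` (`d ≥ 1`). [folklore] -/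
theorem tendsto_card_siteBox_atTop (hd : 1 ≤ d) : Tendsto (fun M : ℕ => ((siteBox d M).card : ℝ)) atTop atTop := by
  have h1 : Tendsto (fun M : ℕ => (2 * (M : ℝ) + 1) ^ d) atTop atTop :=
    (tendsto_pow_atTop (by omega)).comp (tendsto_atTop_add_const_right _ _ (Tendsto.const_mul_atTop (by norm_num) tendsto_natCast_atTop_atTop))
  refine h1.congr fun M => ?_
  rw [ThermodynamicVariance.card_siteBox]; push_cast; ring

/-- **The number of plaquettes touching a cube's links per plaquette based in the cube tends to one**: `#T(boxLinks d M)/(#B_M·#planes(d)) → 1`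
(`d ≥ 2`). [folklore] -/
theorem tendsto_card_plaquettesTouching_boxLinks_div (hd : 2 ≤ d) :
    Tendsto (fun M : ℕ => ((plaquettesTouching (boxLinks d M)).card : ℝ) /
      ((siteBox d M).card * Fintype.card {q : Fin d × Fin d // q.1 < q.2})) atTop (𝓝 1) := by
  have hpl : 0 < Fintype.card {q : Fin d × Fin d // q.1 < q.2} := by
    have : Nonempty {q : Fin d × Fin d // q.1 < q.2} := ⟨⟨(⟨0, by omega⟩, ⟨1, by omega⟩), by simp [Fin.lt_def]⟩⟩
    exact Fintype.card_pos
  have hplpos : (0 : ℝ) < Fintype.card {q : Fin d × Fin d // q.1 < q.2} := by exact_mod_cast hpl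
  have hM : Tendsto (fun M : ℕ => 2 * (M : ℝ) + 1) atTop atTop :=
    tendsto_atTop_add_const_right _ _ (Tendsto.const_mul_atTop (by norm_num) tendsto_natCast_atTop_atTop)
  have h2 : Tendsto (fun M : ℕ => (1 + 2 / (2 * (M : ℝ) + 1)) ^ d) atTop (𝓝 ((1 + 0) ^ d)) :=
    (tendsto_const_nhds.add (tendsto_const_nhds.div_atTop hM)).pow d
  rw [add_zero, one_pow] at h2
  refine tendsto_of_tendsto_of_tendsto_of_le_of_le' tendsto_const_nhds h2 ?_ ?_
  · filter_upwards [eventually_ge_atTop 0] with M _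
    have hB : ((siteBox d M).card : ℝ) = (2 * (M : ℝ) + 1) ^ d := by
      rw [ThermodynamicVariance.card_siteBox]; push_cast; ring
    have hpos : (0 : ℝ) < 2 * (M : ℝ) + 1 := by positivity
    rw [hB, le_div_iff₀ (by positivity), one_mul]
    nlinarith [(card_plaquettesTouching_boxLinks_ge_le (d := d) M).1, pow_pos hpos d]
  · filter_upwards [eventually_ge_atTop 0] with M _
    have hB : ((siteBox d M).card : ℝ) = (2 * (M : ℝ) + 1) ^ d := by
      rw [ThermodynamicVariance.card_siteBox]; push_cast; ring
    have hpos : (0 : ℝ) < 2 * (M : ℝ) + 1 := by positivity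
    rw [hB, show 1 + 2 / (2 * (M : ℝ) + 1) = (2 * (M : ℝ) + 3) / (2 * (M : ℝ) + 1) by field_simp; ring, div_pow,
      div_le_div_iff₀ (by positivity) (by positivity)]
    nlinarith [(card_plaquettesTouching_boxLinks_ge_le (d := d) M).2, pow_pos hpos d]

end BoundaryFreeEnergy

end Summit.Ventures.YMGap.RobustBall

end
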